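import Literature.Geometry.Riemannian.GurskyViaclovskyClosednessChartSmoothness
import HarnessLib

/-!
# Gursky–Viaclovsky closedness: admissibility margin of hybrid jets

Support file (everything PROVED; no definition, no named fact) for the named fact
`Literature.Geometry.Riemannian.gurskyViaclovsky_pathClosed_weighted_four`.

Gilbarg–Trudinger's proof of Thm. 17.14 (book p. 461) evaluates `F` at HYBRID jets
`(y, u(y), Du(y), D²u(x))`, `x ∈ B_{2R}`, `y ∈ B_R`, and uses concavity between `D²u(y)` and
`D²u(x)` with the lower-order data frozen at `y`. For Gursky–Viaclovsky's operator the concave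
function `σ₂^{1/2}` is only available on the admissible cone, so one needs the hybrid jets to be
admissible WITH MARGIN on balls of radius `≤ δ₀` with `δ₀` uniform along the sequence. This is
elementary: the frame-free invariants of `G⁻¹𝒜^t(y,p,r)` — `τ = tr_G 𝒜` (`mtrAt`) and
`Σ = ½((tr_G 𝒜)² − |𝒜|²_G) = σ₂(G⁻¹𝒜)` — are `C^∞` in the jet (ChartSmoothness file), hence
Lipschitz on compact convex jet sets, and the hybrid jet differs from the admissible jet
`(x, u(x), Du(x), D²u(x))` by `‖x − y‖ + ‖Du(y) − Du(x)‖ ≤ (1 + sup‖D²u‖)‖x − y‖`.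

* `exists_lipschitz_of_contDiffOn` — `C¹` on an open set ⇒ Lipschitz (with an explicit `∃ L`)
  on every compact convex subset (mean value inequality + compactness);
* `half_le_of_lipschitz` — the margin arithmetic: `c ≤ f j`, `|f j' − f j| ≤ L‖j' − j‖`,
  `L‖j' − j‖ ≤ c/2` ⇒ `c/2 ≤ f j'`;
* `exists_lipschitz_trace_gvForm`, `exists_lipschitz_sigma2_gvForm` — Lipschitz bounds for
  `τ` and `Σ` on the compact convex jet sets `B̄(y₀,ρ) × B̄(0,P₀) × B̄(0,R₀)` over a chart ball
  `B̄(y₀, ρ) ⊆ V`.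

## References

* D. Gilbarg, N. S. Trudinger, *Elliptic Partial Differential Equations of Second Order* (2001),
  §17.4, proof of Thm. 17.14 (use of (ii)' at hybrid points). [GilbargTrudinger2001]
* M. J. Gursky, J. A. Viaclovsky, J. Differential Geom. 63 (2003) 131–154, Prop. 6.
  [GurskyViaclovsky2003]
-/

noncomputable section

set_option maxSynthPendingDepth 3

open scoped ContDiff Topology
open Set Function Metric

namespace Literature.Geometry.Riemannian.GurskyViaclovskyPath

open Literature.Geometry.Lorentzian
open Literature.Geometry.Lorentzian.MetricCoord

/-! ### Generic: `C¹` on an open set is Lipschitz on compact convex subsets -/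

section Generic

variable {X : Type*} [NormedAddCommGroup X] [NormedSpace ℝ X]

/-- **`C¹` functions are Lipschitz on compact convex subsets of their open domain** (mean value
inequality with the maximum of `‖Df‖` on the compact set). [folklore] -/
theorem exists_lipschitz_of_contDiffOn {f : X → ℝ} {V K : Set X} (hV : IsOpen V)
    (hf : ContDiffOn ℝ 1 f V) (hK : IsCompact K) (hKc : Convex ℝ K) (hKV : K ⊆ V) :
    ∃ L : ℝ, 0 ≤ L ∧ ∀ x ∈ K, ∀ y ∈ K, |f y - f x| ≤ L * ‖y - x‖ := by
  have hcont : ContinuousOn (fun x ↦ fderiv ℝ f x) V :=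
    hf.continuousOn_fderiv_of_isOpen hV le_rfl
  obtain ⟨C, hC⟩ := hK.exists_bound_of_continuousOn (hcont.mono hKV)
  refine ⟨max C 0, le_max_right _ _, fun x hx y hy ↦ ?_⟩
  have hdiff : ∀ z ∈ K, DifferentiableAt ℝ f z := fun z hz ↦
    (hf.differentiableOn one_ne_zero z (hKV hz)).differentiableAt (hV.mem_nhds (hKV hz))
  have h := hKc.norm_image_sub_le_of_norm_fderiv_le hdiff
    (fun z hz ↦ (hC z hz).trans (le_max_left C 0)) hx hy
  rwa [Real.norm_eq_abs] at h

omit [NormedSpace ℝ X] in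
/-- **Margin arithmetic**: a quantity `≥ c` at `j` with Lipschitz constant `L` is `≥ c/2` at
every `j'` with `L‖j' − j‖ ≤ c/2`. [folklore] -/
theorem half_le_of_lipschitz {f : X → ℝ} {j j' : X} {L c : ℝ}
    (h : |f j' - f j| ≤ L * ‖j' - j‖) (hc : c ≤ f j) (hd : L * ‖j' - j‖ ≤ c / 2) :
    c / 2 ≤ f j' := by
  have h1 := (abs_le.1 h).1
  linarith

end Generic

/-! ### The invariants of `G⁻¹𝒜^t` are Lipschitz on compact jet sets -/

section JetLipschitz

variable {E : Type*} [NormedAddCommGroup E] [NormedSpace ℝ E] [FiniteDimensional ℝ E]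
  [CompleteSpace E] {G : E → E →L[ℝ] E →L[ℝ] ℝ} {V : Set E}

/-- The jet space `E × E* × Bil(E)`. -/
local notation "Jet" E => E × (E →L[ℝ] ℝ) × (E →L[ℝ] E →L[ℝ] ℝ)

omit [CompleteSpace E] in
/-- The jet sets `B̄(y₀,ρ) × B̄(0,P₀) × B̄(0,R₀)` are compact and convex, and lie over `V` when
the chart ball does. [folklore] -/
theorem jetSet_compact_convex (y₀ : E) (ρ P₀ R₀ : ℝ) :
    IsCompact (closedBall y₀ ρ ×ˢ (closedBall (0 : E →L[ℝ] ℝ) P₀ ×ˢ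
      closedBall (0 : E →L[ℝ] E →L[ℝ] ℝ) R₀)) ∧
    Convex ℝ (closedBall y₀ ρ ×ˢ (closedBall (0 : E →L[ℝ] ℝ) P₀ ×ˢ
      closedBall (0 : E →L[ℝ] E →L[ℝ] ℝ) R₀)) :=
  ⟨(isCompact_closedBall y₀ ρ).prod ((isCompact_closedBall _ _).prod (isCompact_closedBall _ _)),
    (convex_closedBall y₀ ρ).prod ((convex_closedBall _ _).prod (convex_closedBall _ _))⟩

/-- **`τ = tr_G 𝒜^t` is Lipschitz on compact jet sets** over a chart ball `B̄(y₀,ρ) ⊆ V`.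
[cite: GilbargTrudinger2001, §17.4 (hybrid jets in the proof of Thm. 17.14)] -/
theorem exists_lipschitz_trace_gvForm (hG : IsMetricOn G V) (t : ℝ) {y₀ : E} {ρ : ℝ}
    (hball : closedBall y₀ ρ ⊆ V) (P₀ R₀ : ℝ) :
    ∃ L : ℝ, 0 ≤ L ∧
      ∀ j ∈ closedBall y₀ ρ ×ˢ (closedBall (0 : E →L[ℝ] ℝ) P₀ ×ˢ
          closedBall (0 : E →L[ℝ] E →L[ℝ] ℝ) R₀),
      ∀ j' ∈ closedBall y₀ ρ ×ˢ (closedBall (0 : E →L[ℝ] ℝ) P₀ ×ˢ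
          closedBall (0 : E →L[ℝ] E →L[ℝ] ℝ) R₀),
        |mtrAt G j'.1 (gvForm G t j'.1 j'.2.1 j'.2.2) - mtrAt G j.1 (gvForm G t j.1 j.2.1 j.2.2)| ≤
          L * ‖j' - j‖ := by
  have h1 : (1 : ℕ∞ω) ≤ ((⊤ : ℕ∞) : ℕ∞ω) := WithTop.coe_le_coe.mpr le_top
  have hτ : ContDiffOn ℝ 1 (fun x : Jet E ↦ mtrAt G x.1 (gvForm G t x.1 x.2.1 x.2.2))
      ((Prod.fst : (Jet E) → E) ⁻¹' V) :=
    (contDiffOn_mtrAt_jet hG (contDiffOn_gvForm hG t)).of_le h1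
  have hVo : IsOpen ((Prod.fst : (Jet E) → E) ⁻¹' V) := hG.isOpen.preimage continuous_fst
  obtain ⟨hK, hKc⟩ := jetSet_compact_convex y₀ ρ P₀ R₀ (E := E)
  have hKV : closedBall y₀ ρ ×ˢ (closedBall (0 : E →L[ℝ] ℝ) P₀ ×ˢ
      closedBall (0 : E →L[ℝ] E →L[ℝ] ℝ) R₀) ⊆ (Prod.fst : (Jet E) → E) ⁻¹' V :=
    fun j hj ↦ hball hj.1
  exact exists_lipschitz_of_contDiffOn hVo hτ hK hKc hKV

/-- **`Σ = σ₂(G⁻¹𝒜^t) = ½((tr_G 𝒜)² − |𝒜|²_G)` is Lipschitz on compact jet sets** over a chart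
ball `B̄(y₀,ρ) ⊆ V` — so hybrid jets at distance `≤ c/(2L)` from admissible jets with
`Σ ≥ c` have `Σ ≥ c/2` (`half_le_of_lipschitz`).
[cite: GilbargTrudinger2001, §17.4 (hybrid jets in the proof of Thm. 17.14)]
[cite: GurskyViaclovsky2003, Prop. 6 (proof)] -/
theorem exists_lipschitz_sigma2_gvForm (hG : IsMetricOn G V) (t : ℝ) {y₀ : E} {ρ : ℝ}
    (hball : closedBall y₀ ρ ⊆ V) (P₀ R₀ : ℝ) :
    ∃ L : ℝ, 0 ≤ L ∧
      ∀ j ∈ closedBall y₀ ρ ×ˢ (closedBall (0 : E →L[ℝ] ℝ) P₀ ×ˢ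
          closedBall (0 : E →L[ℝ] E →L[ℝ] ℝ) R₀),
      ∀ j' ∈ closedBall y₀ ρ ×ˢ (closedBall (0 : E →L[ℝ] ℝ) P₀ ×ˢ
          closedBall (0 : E →L[ℝ] E →L[ℝ] ℝ) R₀),
        |1 / 2 * (mtrAt G j'.1 (gvForm G t j'.1 j'.2.1 j'.2.2) ^ 2 -
              normSqAt G j'.1 (gvForm G t j'.1 j'.2.1 j'.2.2)) -
            1 / 2 * (mtrAt G j.1 (gvForm G t j.1 j.2.1 j.2.2) ^ 2 -
              normSqAt G j.1 (gvForm G t j.1 j.2.1 j.2.2))| ≤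
          L * ‖j' - j‖ := by
  have h1 : (1 : ℕ∞ω) ≤ ((⊤ : ℕ∞) : ℕ∞ω) := WithTop.coe_le_coe.mpr le_top
  have hA := contDiffOn_gvForm hG t (V := V)
  have hS : ContDiffOn ℝ 1 (fun x : Jet E ↦ 1 / 2 * (mtrAt G x.1 (gvForm G t x.1 x.2.1 x.2.2) ^ 2 -
      normSqAt G x.1 (gvForm G t x.1 x.2.1 x.2.2))) ((Prod.fst : (Jet E) → E) ⁻¹' V) :=
    (contDiffOn_const.mul (((contDiffOn_mtrAt_jet hG hA).pow 2).sub
      (contDiffOn_normSqAt_jet hG hA))).of_le h1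
  have hVo : IsOpen ((Prod.fst : (Jet E) → E) ⁻¹' V) := hG.isOpen.preimage continuous_fst
  obtain ⟨hK, hKc⟩ := jetSet_compact_convex y₀ ρ P₀ R₀ (E := E)
  have hKV : closedBall y₀ ρ ×ˢ (closedBall (0 : E →L[ℝ] ℝ) P₀ ×ˢ
      closedBall (0 : E →L[ℝ] E →L[ℝ] ℝ) R₀) ⊆ (Prod.fst : (Jet E) → E) ⁻¹' V :=
    fun j hj ↦ hball hj.1
  exact exists_lipschitz_of_contDiffOn hVo hS hK hKc hKV

end JetLipschitz

end Literature.Geometry.Riemannian.GurskyViaclovskyPath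

end
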